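import Mathlib
import Summits.Ventures.PercRepro.TriangleCapTopTwentyFive

/-!
# PercRepro — THE BAND LOCUS OF EVERY LAYER, AND THE FOURTH BAND (p3, gen 51; part 229)

The layer theorem (`pair_count_layer`) puts every triangle-free graph with `s` edges into the band of its
max-degree layer `t = s − Δ`: `Σ d² + 2 t (s − t − 1) + 2 j = s (s + 1)` with `2 j ≤ t (t + 1)`.  The band bottoms
`B(t) = 2 t (s − t − 1) + t (t + 1)` increase in `t` and the level-`t` tail (`sum_deg_sq_le_of_maxdeg_level`) lies
below the band `t` as soon as `2 s ≥ 4 t + 6 + t (t + 1)`.  So (`layer_band_locus`): a graph at a band-`t` value with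
`2 s ≥ 4 t + 6 + t (t + 1)` has a vertex `w` of degree `s − t` with exactly `t` off-edges and
`2·attach + offAdjPairs + 2 j = t (t + 1)` — `j` counts the off-edges missing `N(w)` plus the disjoint pairs among
them.  `pair_count_spectrum_level` is the spectrum down to any level `T`.  The fourth band (`t = 4`, `s ≥ 21`,
`j ≤ 10`, `2·attach + offAdjPairs + 2 j = 20`) is the instance `fourth_band_locus`; on the cell
`cherry_fourth_band_locus` (`21 ≤ r`, `8 (r − 5) + 20 < stabGapFull k a r`) and, for every layer,
`cherry_band_locus_level`.  Axioms: standard.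
-/

namespace PercRepro

namespace TriangleCap

namespace C047

open Finset

variable {V : Type*} [Fintype V] [DecidableEq V]

/-- The band bottoms increase: for `t' < t` and `2 s ≥ 4 t + 6 + t (t + 1)`,
`2 t' (s − t' − 1) + t' (t' + 1) < 2 t (s − t − 1)`. -/
theorem band_bottom_lt (s t t' : ℕ) (hlt : t' < t) (hs : 4 * t + 6 + t * (t + 1) ≤ 2 * s) :
    2 * (t' * (s - t' - 1)) + t' * (t' + 1) < 2 * (t * (s - t - 1)) := by
  obtain ⟨u, rfl⟩ : ∃ u, t = t' + u + 1 := ⟨t - t' - 1, by omega⟩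
  obtain ⟨v, rfl⟩ : ∃ v, s = t' + u + 1 + 2 + v := ⟨s - (t' + u + 1) - 2, by omega⟩
  have e1 : t' + u + 1 + 2 + v - t' - 1 = u + v + 2 := by omega
  have e2 : t' + u + 1 + 2 + v - (t' + u + 1) - 1 = v + 1 := by omega
  rw [e1, e2]
  nlinarith

/-- **THE BAND LOCUS OF EVERY LAYER** (`1 ≤ t`, `2 s ≥ 4 t + 6 + t (t + 1)`, `2 j ≤ t (t + 1)`): a triangle-free
graph with `s` edges and `Σ d² + 2 t (s − t − 1) + 2 j = s (s + 1)` has a vertex `w` of degree `s − t` with exactly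
`t` off-edges and `2·attach + offAdjPairs + 2 j = t (t + 1)`. -/
theorem layer_band_locus (H : SimpleGraph V) [DecidableRel H.Adj] (hfree : H.CliqueFree 3) (t s : ℕ) (ht : 1 ≤ t)
    (hs : 4 * t + 6 + t * (t + 1) ≤ 2 * s) (hs4 : 4 * t + 3 ≤ s) (hm : H.edgeFinset.card = s) (j : ℕ)
    (hj : 2 * j ≤ t * (t + 1))
    (hS : ∑ v, deg H v * deg H v + 2 * (t * (s - t - 1)) + 2 * j = s * (s + 1)) :
    ∃ w, deg H w + t = s ∧ (offEdges H w).card = t ∧ 2 * attach H w + offAdjPairs H w + 2 * j = t * (t + 1) := by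
  have hs1 : 1 ≤ s := by omega
  obtain ⟨w, hwmax, hoff, j', hj', hlayer⟩ := pair_count_layer H hfree (by omega)
  rw [hm] at hoff hlayer
  obtain ⟨t', ht'⟩ : ∃ t', (offEdges H w).card = t' := ⟨_, rfl⟩
  rw [ht'] at hoff hj' hlayer
  have hj'2 : 2 * j' ≤ t' * (t' + 1) := by omega
  have htt : t' = t := by
    by_contra hne
    rcases Nat.lt_or_gt_of_ne hne with hlt | hgt
    · -- the band `t'` lies strictly above the band `t`
      have hb := band_bottom_lt s t t' hlt hs
      have e : deg H w - 1 = s - t' - 1 := by omega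
      rw [e] at hlayer
      omega
    · -- the level-`t` tail lies strictly below the band `t`
      have hΔ : ∀ v, deg H v + t + 1 ≤ H.edgeFinset.card := fun v => by
        have := hwmax v
        omega
      have htail := sum_deg_sq_le_of_maxdeg_level H hfree t (by omega) hΔ
      rw [hm] at htail
      obtain ⟨v, rfl⟩ : ∃ v, s = t + 2 + v := ⟨s - t - 2, by omega⟩
      have e1 : t + 2 + v - t - 2 = v := by omega
      have e2 : t + 2 + v - t - 1 = v + 1 := by omega
      rw [e1] at htail
      rw [e2] at hS
      nlinarith
  subst htt
  refine ⟨w, by omega, ht', ?_⟩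
  have hdec := sum_deg_sq_vertex_decomposition H w
  rw [ht'] at hdec
  obtain ⟨d, hd⟩ : ∃ d, deg H w = d := ⟨_, rfl⟩
  rw [hd] at hdec hoff
  obtain ⟨d', rfl⟩ : ∃ d', d = d' + 1 := ⟨d - 1, by omega⟩
  obtain ⟨rfl⟩ : s = d' + 1 + t' := by omega
  have e : d' + 1 + t' - t' - 1 = d' := by omega
  rw [e] at hS
  rw [hdec] at hS
  zify at hS ⊢
  linear_combination hS

/-- **THE SPECTRUM DOWN TO ANY LEVEL `T`** (`4 T + 3 ≤ s`): a triangle-free graph with `s` edges sits in the band of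
some layer `t ≤ T` (`Σ d² + 2 t (s − t − 1) + 2 j = s (s + 1)`, `2 j ≤ t (t + 1)`) or in the level-`T` tail
`Σ d² + 2 (T + 1)(s − T − 2) ≤ s (s + 1)`. -/
theorem pair_count_spectrum_level (H : SimpleGraph V) [DecidableRel H.Adj] (hfree : H.CliqueFree 3) (T s : ℕ)
    (hs : 4 * T + 3 ≤ s) (hm : H.edgeFinset.card = s) :
    (∃ t, t ≤ T ∧ ∃ j, 2 * j ≤ t * (t + 1) ∧
        ∑ v, deg H v * deg H v + 2 * (t * (s - t - 1)) + 2 * j = s * (s + 1)) ∨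
      ∑ v, deg H v * deg H v + 2 * ((T + 1) * (s - T - 2)) ≤ s * (s + 1) := by
  obtain ⟨w, hwmax, hcard, j, hj, hlayer⟩ := pair_count_layer H hfree (by omega)
  rw [hm] at hcard hlayer
  obtain ⟨t, ht⟩ : ∃ t, (offEdges H w).card = t := ⟨_, rfl⟩
  rw [ht] at hcard hj hlayer
  by_cases htT : t ≤ T
  · left
    refine ⟨t, htT, j, by omega, ?_⟩
    rcases Nat.eq_zero_or_pos t with rfl | hpos
    · simpa using hlayer
    · have e : deg H w - 1 = s - t - 1 := by omega
      rw [e] at hlayer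
      exact hlayer
  · right
    have hΔ : ∀ v, deg H v + T + 1 ≤ H.edgeFinset.card := fun v => by
      have := hwmax v
      omega
    have := sum_deg_sq_le_of_maxdeg_level H hfree T (by omega) hΔ
    rw [hm] at this
    exact this

/-- **THE FOURTH-BAND LOCI OF THE PAIR COUNT** (`s ≥ 21`, `j ≤ 10`): `Σ h² + 8 (s − 5) + 2 j = s (s + 1)` forces a
vertex `w` of degree `s − 4` (four off-edges) with `2·attach + offAdjPairs + 2 j = 20`. -/
theorem fourth_band_locus (H : SimpleGraph V) [DecidableRel H.Adj] (hfree : H.CliqueFree 3) (s : ℕ)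
    (hs : 21 ≤ s) (hm : H.edgeFinset.card = s) (j : ℕ) (hj : j ≤ 10)
    (hS : ∑ v, deg H v * deg H v + 8 * (s - 5) + 2 * j = s * (s + 1)) :
    ∃ w, deg H w + 4 = s ∧ (offEdges H w).card = 4 ∧ 2 * attach H w + offAdjPairs H w + 2 * j = 20 := by
  have h := layer_band_locus H hfree 4 s (by norm_num) (by omega) (by omega) hm j (by omega) (by
    have e : 2 * (4 * (s - 4 - 1)) = 8 * (s - 5) := by omega
    rw [e]
    exact hS)
  simpa using h

/-- **THE BAND LOCI ON THE CELL FOR EVERY LAYER** (`3 ≤ a`, `1 ≤ t`, `4 t + 6 + t (t + 1) ≤ 2 r`, `4 t + 3 ≤ r`, `2 a + r ≤ k`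
(`r + 7 ≤ k` at `a = 3`), `2 j ≤ t (t + 1)`, `2 t (r − t − 1) + t (t + 1) < stabGapFull k a r`): a `K₄⁻`-free graph at
`closed − (2 t (r − t − 1) + 2 j)` is `a`-bipartite and its missing graph has a vertex `w` of degree `r − t` with
`t` off-edges and `2·attach + offAdjPairs + 2 j = t (t + 1)`. -/
theorem cherry_band_locus_level (k a r t : ℕ) (ha3 : 3 ≤ a) (ht : 1 ≤ t) (hr : 4 * t + 6 + t * (t + 1) ≤ 2 * r)
    (hr4 : 4 * t + 3 ≤ r) (hk : 2 * a + r ≤ k) (hk3 : a = 3 → r + 7 ≤ k) (j : ℕ) (hj : 2 * j ≤ t * (t + 1))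
    (hlt : 2 * (t * (r - t - 1)) + t * (t + 1) < stabGapFull k a r)
    (D : SimpleGraph (Fin k)) [DecidableRel D.Adj] (hK : K4mFree D) (hm : D.edgeFinset.card + r = a * (k - a))
    (heq : ∑ v, deg D v * deg D v + r * (k - 1 - r) + (2 * (t * (r - t - 1)) + 2 * j) = D.edgeFinset.card * k) :
    ∃ A : Finset (Fin k), A.card = a ∧ BipSub D A ∧
      ∃ w, deg (missingGraph D A) w + t = r ∧ (offEdges (missingGraph D A) w).card = t ∧
        2 * attach (missingGraph D A) w + offAdjPairs (missingGraph D A) w + 2 * j = t * (t + 1) := by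
  have hcard : Fintype.card (Fin k) = k := Fintype.card_fin k
  have hbip : ∃ A : Finset (Fin k), A.card = a ∧ BipSub D A := by
    by_contra hnb
    have h := (stab_table_rows_ge_three k a r ha3 hk (by omega) hk3).1 D hK hm hnb
    omega
  obtain ⟨A, hA, hB⟩ := hbip
  refine ⟨A, hA, hB, ?_⟩
  have hH := bipSub_sum_deg_sq_add_disjEdgePairs D A hB a r hA (by rw [hcard]; exact hm) (by rw [hcard]; omega)
  rw [hcard] at hH
  have hr' : (missingGraph D A).edgeFinset.card = r := card_edges_missingGraph D A hB a r hA (by rw [hcard]; exact hm)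
  have hid := sum_deg_sq_add_disjEdgePairs (missingGraph D A)
  rw [hr'] at hid
  have hS : ∑ v, deg (missingGraph D A) v * deg (missingGraph D A) v + 2 * (t * (r - t - 1)) + 2 * j =
      r * (r + 1) := by
    omega
  exact layer_band_locus (missingGraph D A) (cliqueFree_of_bipSub _ A (bipSub_missingGraph D A)) t r ht hr hr4 hr' j
    hj hS

/-- **THE FOURTH-BAND LOCI ON THE CELL** (`3 ≤ a`, `21 ≤ r`, `2 a + r ≤ k` (`r + 7 ≤ k` at `a = 3`), `j ≤ 10`,
`8 (r − 5) + 20 < stabGapFull k a r`): a `K₄⁻`-free graph at `closed − (8 (r − 5) + 2 j)` is `a`-bipartite and its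
missing graph has a vertex `w` of degree `r − 4` with `2·attach + offAdjPairs + 2 j = 20`. -/
theorem cherry_fourth_band_locus (k a r : ℕ) (ha3 : 3 ≤ a) (hr21 : 21 ≤ r) (hk : 2 * a + r ≤ k)
    (hk3 : a = 3 → r + 7 ≤ k) (j : ℕ) (hj : j ≤ 10) (hlt : 8 * (r - 5) + 20 < stabGapFull k a r)
    (D : SimpleGraph (Fin k)) [DecidableRel D.Adj] (hK : K4mFree D) (hm : D.edgeFinset.card + r = a * (k - a))
    (heq : ∑ v, deg D v * deg D v + r * (k - 1 - r) + (8 * (r - 5) + 2 * j) = D.edgeFinset.card * k) :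
    ∃ A : Finset (Fin k), A.card = a ∧ BipSub D A ∧
      ∃ w, deg (missingGraph D A) w + 4 = r ∧ (offEdges (missingGraph D A) w).card = 4 ∧
        2 * attach (missingGraph D A) w + offAdjPairs (missingGraph D A) w + 2 * j = 20 := by
  have e : 2 * (4 * (r - 4 - 1)) = 8 * (r - 5) := by omega
  have h := cherry_band_locus_level k a r 4 ha3 (by norm_num) (by omega) (by omega) hk hk3 j (by omega)
    (by rw [e]; norm_num; omega) D hK hm (by rw [e]; exact heq)
  simpa using h

end C047

end TriangleCap

end PercRepro
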